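import Literature.AnabelianGeometry.SemiGraphs.TemperedAbsolutenessLeafReduction
import Literature.AnabelianGeometry.SemiGraphs.TemperedDecompositionOfGalSect
import HarnessLib

/-!
# [SemiAnbd] Cor. 6.10 / Cor. 6.11 (F-1656 / F-1655): the [Mzk8] Thm. 1.3 leaves of the NAMED-LEAF closers
# DISCHARGED BY NAME from the typed [GalSect] Thm. 1.3 (ii) (FACT-LIST row F-0103) and the L4 cuspidal-data
# interface, through the tempered ↔ profinite dictionary

Mochizuki, *Semi-graphs of anabelioids*, Publ. RIMS **42** (2006) [SemiAnbd], §6, Cor. 6.10 (Tempered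
Absoluteness) (i), (ii) and Cor. 6.11, manuscript p. 77 (proof of Cor. 6.10: p. 77 l. 32–47 «… also forms a
"profinite `D_x ⊆ Π_{X_K}`" in the sense of [Mzk8] … We thus conclude [cf. Theorem 6.6] …»; Cor. 6.11:
p. 78 l. 1–2), over [Mzk8] = Mochizuki, *Galois sections in absolute anabelian geometry*, Nagoya Math. J.
**179** (2005), Thm. 1.3 (i), (ii) p. 6. [cite: MochizukiSemiAnbd2006, Cor 6.10 p.77]
[cite: MochizukiSemiAnbd2006, Cor 6.11 pp.77-78] [cite: MochizukiGalSect2005, Thm 1.3 (ii) p.6]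

PROOF-ONLY successor (abc-iut cell, D-0079 L-F sub-cell [SemiAnbd]+[CombGC], pack D «§6 tempered anabelian
(deep)», `plan/L3/LF-SGA.tsv` rows F-1656 / F-1655, residual «[GalSect] Thm 1.3 (ii)@Π̂, TemperedCurve-side
reading `h13ii`, L4-bridge owed»; seat abc-iut-f-168 gen 6) of this seat's gen-5 closers
`AbsolutenessOrigin.temperedAbsolutenessHolds_of_leaves` / `genusZeroTempAbsolutenessHolds_of_leaves`
(`TemperedAbsolutenessLeafReduction.lean`, p452711).  No definition, no new named fact, nothing of the frozen
interfaces restated; abc-iut-f-174's dictionary file `TemperedDecompositionOfGalSect.lean` (p433477: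
`commensurator_eq_of_commensurator_map_eq`, the dictionary shape `j`, `κ`, `hκ`) is consumed verbatim.

Those closers display, per certified curve `Y`, the two [Mzk8] Thm. 1.3 leaves in abc-iut-f-174's binder
shapes at the profinite completion `Π_{Y_L} = Y.PiHat`: `h13i` (conjugate images `ι(D_x)`, `ι(D_{x'})` force
`x' = x`, ALL closed points) and `h13ii` (`ι(D_x)` commensurably terminal, ALL closed points).  The gen-0
proof they feed (`temperedAbsolutenessHolds_of_laws`, p433627) uses both ONLY AT CUSPS (`hrig`, `hnorm`,
`hnormI`).  At cusps both are supplied by the layer-L4 typing of [GalSect]: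

* `h13ii` at a cusp `x` ⟸ the FIRST clause of the FACT-LIST row **F-0103 `GalSect.Thm_1_3_ii_cusps C`**
  («`D_x` is commensurably terminal in `Π_{X_K}`», [GalSect] Thm. 1.3 (ii) p. 6) at an L4 cuspidal datum
  `C : E.CuspidalData` identified with the cusps of `Y` by the dictionary (`j : Π_{Y_L} →ₜ* E.arith`
  injective, cusp index `κ`, `C.Dcusp (κ x) = j(ι(D_x))`) — reflected along `j`
  (`TemperedCurve.commensurator_map_toHat_eq_of_galSect_cusp`; the row F-0104 `Thm_1_3_ii_points` for the
  NON-cuspidal points, which f-174's all-points transfer also takes, is NOT needed here);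
* `h13i` at cusps (= the profinite cusp rigidity `hrig`) ⟸ the interface axiom
  `FundamentalExtension.CuspidalData.eq_of_conj` of the L4 vocabulary («distinct cusps have non-conjugate
  decomposition groups» — [GalSect] Thm. 1.3 (i) for cusps, built into the typed cuspidal data of
  [AbsTopIII] Prop. 1.4 (i)) + FAITHFULNESS of the cusp index `κ` (distinct cusps of `Y` are indexed by
  distinct elements of `C.Cusp` — the dictionary is a bijection on cusps in the intended reading) +
  compactness of the cuspidal decomposition groups (`D̂_x = ι(D_x)`; GAP row G-L5t11g4-1)
  (`TemperedCurve.decompHat_rigid_of_cuspidalData`).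

Results: the re-based closers `AbsolutenessOrigin.temperedAbsolutenessHolds_of_galSect` (F-1656) /
`genusZeroTempAbsolutenessHolds_of_galSect` (F-1655), whose displayed leaves are: F-1707 (`h66`), F-1704
(`h65`) — FACT-LIST, pack D; **F-0103 BY NAME** inside the dictionary hypothesis `hgs` («every certified curve
admits an L4 cuspidal datum identified with the cusps of its profinite completion, at which the typed
[GalSect] Thm. 1.3 (ii) holds»); G-L5t11g4-1 (`hDc`); G-f168-1 (`hgood`, Kummer-transport functoriality);
G-f168-2 / G-f168-3 (`hsub` / `hstab`, [Mzk8] §4 structure laws); and, for F-1655, G-f168-4 (`hCor411`,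
[Mzk8] Cor. 4.11 absolute).  Compared with p452711 the raw binders `h13i` (GAP G-f174-1, all points) and
`h13ii` (all points) are GONE from these two rows.
HONEST FRAMING: statements about OUR typed interfaces of refereed prerequisite papers; the dictionary is a
hypothesis, not a construction (no tempered or profinite fundamental group of a curve exists in the tree);
every leaf is a displayed hypothesis, never asserted; the `∀Ω` closures of F-1655 / F-1656 stay refuted
(p431240) — these rows have content only at certified data; nothing here bears on, or takes a side on,
[IUTchIII] Cor. 3.12; typed ≠ proved.
-/

noncomputable section

namespace Literature.AnabelianGeometry.SemiGraphs

open scoped Pointwise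
open _root_.Topology
open Subgroup.Commensurable (commensurator)
open Literature.AnabelianGeometry.AbsoluteAnabelian

universe u

variable {p : ℕ} [Fact p.Prime]

/-- The two spellings of conjugating a subgroup agree: `MulAut.conj g • H = ConjAct.toConjAct g • H` (the L4
interface `CuspidalData.eq_of_conj` uses the former, the §6 transfer lemmas the latter). [folklore] -/
private theorem conj_smul_eq_toConjAct_smul_junction {A : Type*} [Group A] (g : A) (H : Subgroup A) :
    MulAut.conj g • H = ConjAct.toConjAct g • H := by
  ext x
  simp only [Subgroup.mem_smul_pointwise_iff_exists, MulAut.smul_def, MulAut.conj_apply, ConjAct.smul_def,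
    ConjAct.ofConjAct_toConjAct]

namespace TemperedCurve

variable (Y : TemperedCurve p)

/-! ### [GalSect] Thm. 1.3 (ii), cusp clause, BY NAME ⇒ the leaf `h13ii` at a cusp -/

/-- **F-0103 `GalSect.Thm_1_3_ii_cusps C` (first clause), by name ⇒ `C_{Π_{Y_L}}(ι(D_x)) = ι(D_x)` at every
cusp `x`.**  Given the dictionary (`j : Π_{Y_L} →ₜ* E.arith` injective, cusp index `κ` with
`C.Dcusp (κ x) = j(ι(D_x))`), commensurable terminality of `C.Dcusp (κ x)` in `E.arith` reflects along `j`
(abc-iut-f-174's `commensurator_eq_of_commensurator_map_eq`) — the leaf `h13ii` of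
`temperedAbsolutenessHolds_of_leaves` at the cusp `x`, which is the only place the Cor. 6.10 proof uses it.
[cite: MochizukiGalSect2005, Thm 1.3 (ii) p.6] -/
theorem commensurator_map_toHat_eq_of_galSect_cusp {E : FundamentalExtension.{u}} (j : Y.PiHat →ₜ* E.arith)
    (hj : Function.Injective j) (C : E.CuspidalData) (κ : ∀ x : Y.Pt, Y.IsCusp x → C.Cusp)
    (hκ : ∀ (x : Y.Pt) (hx : Y.IsCusp x),
      C.Dcusp (κ x hx) = ((Y.decomp x).map Y.toHat.toMonoidHom).map j.toMonoidHom)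
    (hC : GalSect.Thm_1_3_ii_cusps C) (x : Y.Pt) (hx : Y.IsCusp x) :
    commensurator ((Y.decomp x).map Y.toHat.toMonoidHom) = (Y.decomp x).map Y.toHat.toMonoidHom := by
  have hj' : Function.Injective j.toMonoidHom := fun _ _ h => hj h
  apply commensurator_eq_of_commensurator_map_eq hj'
  have h := (hC.1 (κ x hx)).commensurator_eq
  rw [hκ x hx] at h
  exact h

/-! ### The L4 interface axiom `CuspidalData.eq_of_conj` ⇒ the leaf `h13i` at cusps (= `hrig`) -/

/-- **Profinite cusp rigidity `hrig` from the L4 cuspidal-data interface**: if the "profinite" decomposition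
groups `D̂_y`, `D̂_{y'}` of two cusps are `Π_{Y_L}`-conjugate then `y' = y` — from compactness of the cuspidal
decomposition groups (`D̂ = ι(D)`), the dictionary (`j`, `κ`, `hκ`), the interface axiom
`CuspidalData.eq_of_conj` («distinct cusps have non-conjugate decomposition groups», [GalSect] Thm. 1.3 (i)
for cusps as built into the typed data) and faithfulness of the cusp index `κ`.  No FACT-LIST row is consumed.
[cite: MochizukiGalSect2005, Thm 1.3 p.6] -/
theorem decompHat_rigid_of_cuspidalData {E : FundamentalExtension.{u}} (j : Y.PiHat →ₜ* E.arith)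
    (C : E.CuspidalData) (κ : ∀ x : Y.Pt, Y.IsCusp x → C.Cusp)
    (hκinj : ∀ (x x' : Y.Pt) (hx : Y.IsCusp x) (hx' : Y.IsCusp x'), κ x hx = κ x' hx' → x = x')
    (hκ : ∀ (x : Y.Pt) (hx : Y.IsCusp x),
      C.Dcusp (κ x hx) = ((Y.decomp x).map Y.toHat.toMonoidHom).map j.toMonoidHom)
    (hDc : ∀ y : Y.Pt, Y.IsCusp y → IsCompact (Y.decomp y : Set Y.PiTemp)) :
    ∀ y y' : Y.Pt, Y.IsCusp y → Y.IsCusp y' →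
      (∃ g : ConjAct Y.PiHat, Y.decompHat y' = g • Y.decompHat y) → y' = y := by
  rintro y y' hy hy' ⟨g, hg⟩
  rw [decompHat_eq_map_of_isCompact y' (hDc y' hy'), decompHat_eq_map_of_isCompact y (hDc y hy)] at hg
  have hg' := congrArg (Subgroup.map j.toMonoidHom) hg
  -- `j(g • ι(D_y)) = j(g) • j(ι(D_y))`
  have hmap := map_conjAct_smul j.toMonoidHom (ConjAct.ofConjAct g) ((Y.decomp y).map Y.toHat.toMonoidHom)
  rw [ConjAct.toConjAct_ofConjAct] at hmap
  rw [hmap, ← hκ y hy, ← hκ y' hy', ← conj_smul_eq_toConjAct_smul_junction] at hg'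
  exact (hκinj y y' hy hy' (C.eq_of_conj (κ y hy) (κ y' hy') _ hg'.symm)).symm

/-- **Both [Mzk8] Thm. 1.3 leaves of the Cor. 6.10 proof at ONE certified curve, from the dictionary**: the
cusp rigidity `hrig` and the cusp commensurable terminality `h13ii`-at-cusps, packaged.
[cite: MochizukiSemiAnbd2006, Cor 6.10 p.77] -/
theorem thm13_cusp_leaves_of_galSect {E : FundamentalExtension.{u}} (j : Y.PiHat →ₜ* E.arith)
    (hj : Function.Injective j) (C : E.CuspidalData) (κ : ∀ x : Y.Pt, Y.IsCusp x → C.Cusp)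
    (hκinj : ∀ (x x' : Y.Pt) (hx : Y.IsCusp x) (hx' : Y.IsCusp x'), κ x hx = κ x' hx' → x = x')
    (hκ : ∀ (x : Y.Pt) (hx : Y.IsCusp x),
      C.Dcusp (κ x hx) = ((Y.decomp x).map Y.toHat.toMonoidHom).map j.toMonoidHom)
    (hC : GalSect.Thm_1_3_ii_cusps C) (hDc : ∀ y : Y.Pt, Y.IsCusp y → IsCompact (Y.decomp y : Set Y.PiTemp)) :
    (∀ y y' : Y.Pt, Y.IsCusp y → Y.IsCusp y' →
        (∃ g : ConjAct Y.PiHat, Y.decompHat y' = g • Y.decompHat y) → y' = y) ∧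
      ∀ x : Y.Pt, Y.IsCusp x →
        commensurator ((Y.decomp x).map Y.toHat.toMonoidHom) = (Y.decomp x).map Y.toHat.toMonoidHom :=
  ⟨Y.decompHat_rigid_of_cuspidalData j C κ hκinj hκ hDc,
    Y.commensurator_map_toHat_eq_of_galSect_cusp j hj C κ hκ hC⟩

end TemperedCurve

/-! ### The re-based closers -/

namespace AbsolutenessOrigin

variable (Ω : AbsolutenessOrigin p)

/-- **F-1656 `TemperedAbsolutenessHolds Ω` ([SemiAnbd] Cor. 6.10 (i), (ii)) with the [Mzk8] Thm. 1.3 leaves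
DISCHARGED BY NAME from the L4 typing of [GalSect]**: leaves Thm. 6.6 (`h66`, F-1707), Thm. 6.5 (iii) (`h65`,
F-1704); the DICTIONARY hypothesis `hgs` — every certified curve `Y` admits an L4 cuspidal datum
`C : E.CuspidalData` over some `E : FundamentalExtension` with an injective `j : Π_{Y_L} →ₜ* E.arith` and a
faithful cusp index `κ` with `C.Dcusp (κ x) = j(ι(D_x))`, AT WHICH THE FACT-LIST ROW F-0103
`GalSect.Thm_1_3_ii_cusps C` HOLDS; compactness of the decomposition groups (`hDc`, GAP G-L5t11g4-1); the
Kummer-transport functoriality law (`hgood`, GAP G-f168-1); the [Mzk8] §4 structure laws (`hsub` / `hstab`,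
GAP G-f168-2 / G-f168-3).  Composition of `TemperedCurve.decompHat_rigid_of_cuspidalData` /
`commensurator_map_toHat_eq_of_galSect_cusp` with this seat's gen-5 derivations
(`image_smul_hatOf_eq_of_stable`) and the gen-0 closer `temperedAbsolutenessHolds_of_laws` (p433627).
[cite: MochizukiSemiAnbd2006, Cor 6.10 p.77] -/
theorem temperedAbsolutenessHolds_of_galSect
    (h66 : Ω.toTemperedOrigin.ProfiniteOuterIsoLiftsHolds)
    (h65 : Ω.toTemperedOrigin.CuspidalAbsolutenessHolds)
    (hgs : ∀ Y : TemperedCurve p, Ω.IsHyperbolicCurveOrigin Y →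
      ∃ (E : FundamentalExtension.{u}) (j : Y.PiHat →ₜ* E.arith) (C : E.CuspidalData)
        (κ : ∀ x : Y.Pt, Y.IsCusp x → C.Cusp),
        Function.Injective j ∧
          (∀ (x x' : Y.Pt) (hx : Y.IsCusp x) (hx' : Y.IsCusp x'), κ x hx = κ x' hx' → x = x') ∧
          (∀ (x : Y.Pt) (hx : Y.IsCusp x),
            C.Dcusp (κ x hx) = ((Y.decomp x).map Y.toHat.toMonoidHom).map j.toMonoidHom) ∧
          GalSect.Thm_1_3_ii_cusps C)
    (hDc : ∀ Y : TemperedCurve p, Ω.IsHyperbolicCurveOrigin Y → ∀ y : Y.Pt,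
      IsCompact (Y.decomp y : Set Y.PiTemp))
    (hgood : ∀ (X : TemperedCurve p) (kX : KummerUnitData X), Ω.IsHyperbolicCurveOrigin X →
      Ω.IsKummerOrigin kX → ∀ (Y : TemperedCurve p) (kY : KummerUnitData Y) (t : KummerTransport kX kY),
      Ω.IsHyperbolicCurveOrigin Y → Ω.IsKummerOrigin kY → Ω.IsKummerTransportOrigin t →
      ∀ (αhat : X.PiHat ≃ₜ* Y.PiHat) (β : X.PiTemp ≃ₜ* Y.PiTemp), TemperedCurve.LiesUnder X Y αhat β →
        (kX.unitImage).map (t.h1OfHat αhat).toAddMonoidHom =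
          (kX.unitImage).map (t.h1OfTemp β).toAddMonoidHom)
    (hsub : ∀ (Y : TemperedCurve p) (SY : CuspidalStructures Y), Ω.IsHyperbolicCurveOrigin Y →
      Ω.IsStructuresOrigin SY → ∀ y : Y.Pt, Y.IsCusp y → ∀ S ∈ SY.canonicalDiscrete y,
        IsClosed (S : Set Y.PiTemp) ∧ S ≤ Y.decomp y)
    (hstab : ∀ (Y : TemperedCurve p) (SY : CuspidalStructures Y), Ω.IsHyperbolicCurveOrigin Y →
      Ω.IsStructuresOrigin SY → ∀ y : Y.Pt, Y.IsCusp y → ∀ t ∈ Y.decomp y,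
        (∀ S ∈ SY.canonicalDiscrete y, ConjAct.toConjAct t • S ∈ SY.canonicalDiscrete y) ∧
          ∀ S ∈ SY.canonicalIntegral y, ConjAct.toConjAct t • S ∈ SY.canonicalIntegral y) :
    Ω.TemperedAbsolutenessHolds :=
  Ω.temperedAbsolutenessHolds_of_laws h66 h65 hgood
    (fun Y SY hY hSY y hy S hS =>
      (hDc Y hY y).of_isClosed_subset (hsub Y SY hY hSY y hy S hS).1 (hsub Y SY hY hSY y hy S hS).2)
    (fun Y hY => by
      obtain ⟨E, j, C, κ, -, hκinj, hκ, -⟩ := hgs Y hY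
      exact TemperedCurve.decompHat_rigid_of_cuspidalData Y j C κ hκinj hκ fun y _ => hDc Y hY y)
    (fun Y SY hY hSY y hy ε hε => by
      obtain ⟨E, j, C, κ, hj, -, hκ, hC⟩ := hgs Y hY
      exact TemperedCurve.image_smul_hatOf_eq_of_stable y (hDc Y hY y)
        (TemperedCurve.commensurator_map_toHat_eq_of_galSect_cusp Y j hj C κ hκ hC y hy) _
        (fun t ht S hS => (hstab Y SY hY hSY y hy t ht).1 S hS) ε hε)
    (fun Y SY hY hSY y hy ε hε => by
      obtain ⟨E, j, C, κ, hj, -, hκ, hC⟩ := hgs Y hY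
      exact TemperedCurve.image_smul_hatOf_eq_of_stable y (hDc Y hY y)
        (TemperedCurve.commensurator_map_toHat_eq_of_galSect_cusp Y j hj C κ hκ hC y hy) _
        (fun t ht S hS => (hstab Y SY hY hSY y hy t ht).2 S hS) ε hε)

/-- **F-1655 `GenusZeroTempAbsolutenessHolds Ω` ([SemiAnbd] Cor. 6.11) with the [Mzk8] Thm. 1.3 leaves
DISCHARGED BY NAME from the L4 typing of [GalSect]**: the leaves of `temperedAbsolutenessHolds_of_galSect` plus
the ABSOLUTE [Mzk8] Cor. 4.11 (`hCor411`, GAP G-f168-4), through the printed one-line proof (p. 78 l. 1–2)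
`genusZeroTempAbsolutenessHolds_of_temperedAbsolutenessHolds` (p433257).
[cite: MochizukiSemiAnbd2006, Cor 6.11 pp.77-78] -/
theorem genusZeroTempAbsolutenessHolds_of_galSect
    (h66 : Ω.toTemperedOrigin.ProfiniteOuterIsoLiftsHolds)
    (h65 : Ω.toTemperedOrigin.CuspidalAbsolutenessHolds)
    (hgs : ∀ Y : TemperedCurve p, Ω.IsHyperbolicCurveOrigin Y →
      ∃ (E : FundamentalExtension.{u}) (j : Y.PiHat →ₜ* E.arith) (C : E.CuspidalData)
        (κ : ∀ x : Y.Pt, Y.IsCusp x → C.Cusp),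
        Function.Injective j ∧
          (∀ (x x' : Y.Pt) (hx : Y.IsCusp x) (hx' : Y.IsCusp x'), κ x hx = κ x' hx' → x = x') ∧
          (∀ (x : Y.Pt) (hx : Y.IsCusp x),
            C.Dcusp (κ x hx) = ((Y.decomp x).map Y.toHat.toMonoidHom).map j.toMonoidHom) ∧
          GalSect.Thm_1_3_ii_cusps C)
    (hDc : ∀ Y : TemperedCurve p, Ω.IsHyperbolicCurveOrigin Y → ∀ y : Y.Pt,
      IsCompact (Y.decomp y : Set Y.PiTemp))
    (hgood : ∀ (X : TemperedCurve p) (kX : KummerUnitData X), Ω.IsHyperbolicCurveOrigin X →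
      Ω.IsKummerOrigin kX → ∀ (Y : TemperedCurve p) (kY : KummerUnitData Y) (t : KummerTransport kX kY),
      Ω.IsHyperbolicCurveOrigin Y → Ω.IsKummerOrigin kY → Ω.IsKummerTransportOrigin t →
      ∀ (αhat : X.PiHat ≃ₜ* Y.PiHat) (β : X.PiTemp ≃ₜ* Y.PiTemp), TemperedCurve.LiesUnder X Y αhat β →
        (kX.unitImage).map (t.h1OfHat αhat).toAddMonoidHom =
          (kX.unitImage).map (t.h1OfTemp β).toAddMonoidHom)
    (hsub : ∀ (Y : TemperedCurve p) (SY : CuspidalStructures Y), Ω.IsHyperbolicCurveOrigin Y →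
      Ω.IsStructuresOrigin SY → ∀ y : Y.Pt, Y.IsCusp y → ∀ S ∈ SY.canonicalDiscrete y,
        IsClosed (S : Set Y.PiTemp) ∧ S ≤ Y.decomp y)
    (hstab : ∀ (Y : TemperedCurve p) (SY : CuspidalStructures Y), Ω.IsHyperbolicCurveOrigin Y →
      Ω.IsStructuresOrigin SY → ∀ y : Y.Pt, Y.IsCusp y → ∀ t ∈ Y.decomp y,
        (∀ S ∈ SY.canonicalDiscrete y, ConjAct.toConjAct t • S ∈ SY.canonicalDiscrete y) ∧
          ∀ S ∈ SY.canonicalIntegral y, ConjAct.toConjAct t • S ∈ SY.canonicalIntegral y)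
    (hCor411 : ∀ (X : TemperedCurve p) (SX : CuspidalStructures X) (kX : KummerUnitData X)
      (aX : TemperedCurve.CurveArithmeticFlags X), Ω.IsHyperbolicCurveOrigin X →
      Ω.IsStructuresOrigin SX → Ω.IsKummerOrigin kX → Ω.IsFlagsOrigin aX →
      SX.HasStableReduction → aX.IsIsogenousToGenusZero →
        Ω.IsUnitwiseAbsolute kX ∧
          ∀ x : X.Pt, X.IsCusp x → X.IsRationalPt x → Ω.IsIntegrallyAbsoluteCusp SX x) :
    Ω.GenusZeroTempAbsolutenessHolds :=
  Ω.genusZeroTempAbsolutenessHolds_of_temperedAbsolutenessHolds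
    (Ω.temperedAbsolutenessHolds_of_galSect h66 h65 hgs hDc hgood hsub hstab) hCor411

end AbsolutenessOrigin

end Literature.AnabelianGeometry.SemiGraphs

end
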